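import Mathlib
import HarnessLib
import Summits.HubbardSuperconductivity.HubbardSuperconductivity.Theorems.KLProgrammeKLRegimeTwoVolumeSectorPeriodisation
import Summits.HubbardSuperconductivity.HubbardSuperconductivity.Theorems.KLProgrammeKLRegimeSliceSymbolTorus
import Literature.MathematicalPhysics.QuantumLattice.HubbardSectorCovariance

/-!
# Route `KLProgramme` — crux K3, VL child `KLRegimeVolumeLimitV17F2` (stmt-HubbardSuperconductivity-20440), blueprint v5 M3b: THE MODEL'S SLICE SYMBOL AND FAT
# FAMILY ARE SAMPLED (seat hubbard-kl-k3c4-p1 g12; `--supports` 20440)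

The per-scale two-volume step (`…SrcSectorScaleSuccMinS/Bundled`) takes the STEP covariances of both volumes as sector pull-backs `S(F̃)ᵀ·normalCovariance p_V·S(F̃)`
of ONE momentum symbol `Φ` and ONE fat family `𝔣t` SAMPLED on the two lattices (`hpL/hpLf : p_V ((i,q),σ) = (β V²)·Φ i σ (p_q)`, `hFtL/hFtLf : F̃_V ω (i,q) = 𝔣t ω i (p_q)`),
which is what makes them periodise (`sectorPullback_periodise_leg`).  `…TwoVolumeSectorPeriodisation` §5 records this for the thin family (`klAnisoFamily_eq_sampled`);
this file records it for the two remaining model inputs at a common frame `K`: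

* **`bgmFatMultiplier_nambuXiCT_eq_sampled`** — the fat partner `bgmFatMultiplier V M e₀ β (e_K) n` is sampled (same `𝔣t` at every volume);
* **`sliceSymbolFnXi_nambuXiCT_eq_sampled`** — the zero-seed CT slice symbol is `(β V²) ×` a sampled `Φ`:
  `sliceSymbolFnXi (βV²) 0 Λ Λ′ (ω_i) (e_K(p_q)) = (βV²) · Φ i (p_q)` (`sliceSymbolFnXi c … = W · c/(−iω + ξ)` is linear in `c`), i.e. with
  `hubbardCovSliceCT_eq_normalCovariance_sliceSymbolFnXi` the `hpL` hypothesis for `C^K_{(Λ,Λ′]}` at BOTH volumes.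

Proofs only; no definition.  References: BGM 2006 §2.3 (2.28), §2.5 (2.57); Salmhofer 1999 §4.2.5 (4.70).
-/

noncomputable section

namespace Summit.HubbardSuperconductivity.HubbardSuperconductivity.Theorems.TwoPointAssembly

set_option linter.dupNamespace false -- summit = problem name (single-conjunct summit), D-0017

open Finset Literature.MathematicalPhysics.QuantumLattice Literature.Probability.LatticeModels
open Summit.HubbardSuperconductivity.HubbardSuperconductivity.Theorems.KLProgrammeLegKernels

open Classical in
/-- **The fat sector multipliers of a frame `K` are SAMPLED**: `bgmFatMultiplier V M e₀ β (e_K) n ω (i, q) = 𝔣t ω i (p_q)` with ONE `𝔣t` for every volume.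
[folklore] -/
theorem bgmFatMultiplier_nambuXiCT_eq_sampled {V M : ℕ} (e₀ β μ : ℝ) (K : TrigPolyC4v) (n : ℕ) (ω : Fin (sectorCount n)) (i : MatsubaraIdx M)
    (q : TorusSite 2 V) :
    bgmFatMultiplier V M e₀ β (nambuXiCT V μ K) n ω (i, q) =
      (fun (ω' : Fin (sectorCount n)) (i' : MatsubaraIdx M) (p : Fin 2 → ℝ) =>
        (((gnScaleCutoff 4 e₀ (-(n : ℤ) + 1) (Real.sqrt (matsubaraFreq β M i' ^ 2 + (-2 * ∑ j, Real.cos (p j) - μ - K.eval p) ^ 2)) *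
            ∑ ω'' ∈ (range (sectorCount n)).filter
              (fun ω'' : ℕ => ∃ δ : ℤ, |δ| ≤ 1 ∧ (sectorCount n : ℤ) ∣ ((ω'' : ℤ) - ((ω' : ℕ) : ℤ) - δ)),
              sectorWeightCirc n ω'' (polarAngle (fun j => toIocMod Real.two_pi_pos (-Real.pi) (p j))) : ℝ) : ℂ)))
        ω i (latticeMomentum V q) := by
  simp only [bgmFatMultiplier, momentumAngle, nambuXiCT, torusBand]
  rfl

/-- **The zero-seed CT slice symbol is `(β V²) ×` a SAMPLED symbol**:
`sliceSymbolFnXi (βV²) 0 Λ Λ′ ω_i (e_K(q)) = (βV²) · Φ i (p_q)`, `Φ i p = W_{Λ,Λ′}(ω_i, e_K(p)) / (−iω_i + e_K(p))`, ONE `Φ` for every volume — with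
`hubbardCovSliceCT_eq_normalCovariance_sliceSymbolFnXi` the `hpL`/`hpLf` hypothesis of the per-scale two-volume step for `C^K_{(Λ,Λ′]}`. [folklore] -/
theorem sliceSymbolFnXi_nambuXiCT_eq_sampled {V M : ℕ} (β μ : ℝ) (K : TrigPolyC4v) (Λ Λ' : ℝ) (i : MatsubaraIdx M) (q : TorusSite 2 V) (σ : Fin 2) :
    (fun ks : FreqMomentum V M × Fin 2 => sliceSymbolFnXi (β * (V : ℝ) ^ 2) 0 Λ Λ' (matsubaraFreq β M ks.1.1) (nambuXiCT V μ K ks.1.2)) ((i, q), σ) =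
      ((β * (V : ℝ) ^ 2 : ℝ) : ℂ) *
        (fun (i' : MatsubaraIdx M) (_ : Fin 2) (p : Fin 2 → ℝ) =>
          (sliceWeightFn Λ Λ' (matsubaraFreq β M i') (-2 * ∑ j, Real.cos (p j) - μ - K.eval p) : ℂ) /
            (-Complex.I * (((matsubaraFreq β M i' + 0 : ℝ)) : ℂ) + (((-2 * ∑ j, Real.cos (p j) - μ - K.eval p : ℝ)) : ℂ)))
          i σ (latticeMomentum V q) := by
  simp only [sliceSymbolFnXi, resolventFnXi, nambuXiCT, torusBand]
  rw [mul_div_assoc', mul_comm, mul_div_assoc]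

end Summit.HubbardSuperconductivity.HubbardSuperconductivity.Theorems.TwoPointAssembly

end
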